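import Mathlib
import Summits.ValiantsHypothesis.ValiantsHypothesis.Theorems.BarrierLeverPartitionMinorsHitByVPHiddenStatesPathTablePeel
import Summits.ValiantsHypothesis.ValiantsHypothesis.Theorems.BarrierLeverPartitionMinorsHitByVPHiddenStatesPathTableTransfer

/-!
# Route BarrierLever — item `PartitionMinorsHitByVP` (stmt-ValiantsHypothesis-19717), line `hidden-states`:
# TRANSFER COEFFICIENTS AND THE PEELING OF AN UNFED COORDINATE

Helper file (`--supports stmt-ValiantsHypothesis-19717`; cell valiant-natproofs, 𝒟-side door (c), registered line
`Cruxes/PartitionMinorsHitByVP/Lines/hidden_states.lean` v8; prover seat val-np-p6 gen 17).  Closes NO item.  Definition: the transfer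
coefficient `coef w S R` (the weight of the source maps of `S` with image `R`; transparent).

Towards THEOREM 2U of memo HOME/val-np-p6/g17/MEMO-valnp6-g17.md §4 («two unfed tokens with disjoint sources ⇒ the cross minor vanishes»).
A coordinate `q` is UNFED when it is nobody's source (`w a q = 0` for `a ≠ q`) and `w q q = 1`.
* `sum_maps_eq_sum_coef` — `Σ_φ wt(φ) ζ(S.image φ) = Σ_R coef w S R · ζ R`;
* `coef_eq_zero_of_card_lt` — images are not larger than sources; `coef_eq_zero_of_unfed_mem` — images of `S ∌ q` avoid an unfed `q`;
* ★ `coef_insert_unfed` — PEELING: for `q ∉ S` unfed,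
  `coef (S+q) X = [q ∈ X]·coef S (X−q) + Σ_{d ∈ X, d ≠ q} w q d · (coef S X + coef S (X−d))`.

WHAT THIS IS NOT: no determinant is evaluated here; nothing on crux 14610 or VP ≠ VNP.
-/

set_option linter.dupNamespace false

namespace Summit.ValiantsHypothesis.ValiantsHypothesis.Theorems.BarrierLever.HiddenStates

open Finset

noncomputable section

namespace SecondShell

open PathTable (sum_maps_insert)

variable {ι : Type} [Fintype ι] [DecidableEq ι]

/-- the transfer coefficient: total weight of the source maps of `S` with image exactly `R`. -/
def coef (w : ι → ι → ℂ) (S R : Finset ι) : ℂ :=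
  ∑ φ ∈ Fintype.piFinset (fun b => if b ∈ S then (Finset.univ : Finset ι) else {b}),
    (∏ b ∈ S, w b (φ b)) * (if S.image φ = R then 1 else 0)

/-- a source-map sum against a test function is the coefficient pairing. -/
theorem sum_maps_eq_sum_coef (w : ι → ι → ℂ) (ζ : Finset ι → ℂ) (S : Finset ι) :
    ∑ φ ∈ Fintype.piFinset (fun b => if b ∈ S then (Finset.univ : Finset ι) else {b}),
        (∏ b ∈ S, w b (φ b)) * ζ (S.image φ) = ∑ R, coef w S R * ζ R := by
  classical
  simp only [coef, Finset.sum_mul]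
  rw [Finset.sum_comm]
  refine Finset.sum_congr rfl fun φ _ => ?_
  rw [Finset.sum_eq_single (S.image φ)]
  · simp
  · intro R _ hR; rw [if_neg (Ne.symm hR)]; ring
  · intro h; exact (h (Finset.mem_univ _)).elim

omit [Fintype ι] in
/-- images are never larger than their source. -/
theorem card_image_le' (S : Finset ι) (φ : ι → ι) : (S.image φ).card ≤ S.card := Finset.card_image_le

/-- `coef w S R = 0` when `|R| > |S|`. -/
theorem coef_eq_zero_of_card_lt (w : ι → ι → ℂ) {S R : Finset ι} (h : S.card < R.card) : coef w S R = 0 := by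
  classical
  refine Finset.sum_eq_zero fun φ _ => ?_
  rw [if_neg, mul_zero]
  intro himg
  have := card_image_le' S φ
  rw [himg] at this; omega

/-- the images of a set `S ∌ q` under nonzero-weight source maps avoid an unfed coordinate `q`. -/
theorem coef_eq_zero_of_unfed_mem (w : ι → ι → ℂ) {q : ι} (hcol : ∀ a, a ≠ q → w a q = 0) {S R : Finset ι} (hqS : q ∉ S)
    (hqR : q ∈ R) : coef w S R = 0 := by
  classical
  refine Finset.sum_eq_zero fun φ _ => ?_
  by_cases himg : S.image φ = R
  · rw [if_pos himg, mul_one]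
    rw [← himg] at hqR
    obtain ⟨b, hb, hbq⟩ := Finset.mem_image.1 hqR
    refine Finset.prod_eq_zero hb ?_
    rw [hbq]
    exact hcol b (fun h => hqS (h ▸ hb))
  · rw [if_neg himg, mul_zero]

/-- ★ **PEELING AN UNFED COORDINATE.**  For `q ∉ S` with `w q q = 1` and `w a q = 0` (`a ≠ q`):
`coef (S + q) X = [q ∈ X] coef S (X − q) + Σ_{d ∈ X ∖ q} w q d (coef S X + coef S (X − d))`. -/
theorem coef_insert_unfed (w : ι → ι → ℂ) {q : ι} (hcol : ∀ a, a ≠ q → w a q = 0) (hqq : w q q = 1)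
    {S : Finset ι} (hqS : q ∉ S) (X : Finset ι) :
    coef w (insert q S) X = (if q ∈ X then coef w S (X.erase q) else 0) +
      ∑ d ∈ X.erase q, w q d * (coef w S X + coef w S (X.erase d)) := by
  classical
  -- peel with the test function `[· = X]`
  have hpeel := sum_maps_insert w (fun Y => if Y = X then (1 : ℂ) else 0) hqS
  have hL : coef w (insert q S) X = ∑ φ ∈ Fintype.piFinset (fun b => if b ∈ insert q S then (Finset.univ : Finset ι) else {b}),
      (∏ b ∈ insert q S, w b (φ b)) * (if (insert q S).image φ = X then (1 : ℂ) else 0) := rfl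
  rw [hL, hpeel]
  -- rewrite the inner sums through `coef`
  have hR : ∀ e : ι, ∑ φ' ∈ Fintype.piFinset (fun b => if b ∈ S then (Finset.univ : Finset ι) else {b}),
      (∏ b ∈ S, w b (φ' b)) * (if insert e (S.image φ') = X then (1 : ℂ) else 0) =
        ∑ R', coef w S R' * (if insert e R' = X then (1 : ℂ) else 0) :=
    fun e => sum_maps_eq_sum_coef w (fun Y => if insert e Y = X then (1 : ℂ) else 0) S
  have hswap : ∑ φ' ∈ Fintype.piFinset (fun b => if b ∈ S then (Finset.univ : Finset ι) else {b}),
      (∏ b ∈ S, w b (φ' b)) * ∑ e : ι, w q e * (if insert e (S.image φ') = X then (1 : ℂ) else 0) =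
      ∑ e : ι, w q e * ∑ R', coef w S R' * (if insert e R' = X then (1 : ℂ) else 0) := by
    calc ∑ φ' ∈ Fintype.piFinset (fun b => if b ∈ S then (Finset.univ : Finset ι) else {b}),
          (∏ b ∈ S, w b (φ' b)) * ∑ e : ι, w q e * (if insert e (S.image φ') = X then (1 : ℂ) else 0)
        = ∑ φ' ∈ Fintype.piFinset (fun b => if b ∈ S then (Finset.univ : Finset ι) else {b}),
            ∑ e : ι, w q e * ((∏ b ∈ S, w b (φ' b)) * (if insert e (S.image φ') = X then (1 : ℂ) else 0)) := by
          refine Finset.sum_congr rfl fun φ' _ => ?_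
          rw [Finset.mul_sum]
          exact Finset.sum_congr rfl fun e _ => by ring
      _ = ∑ e : ι, ∑ φ' ∈ Fintype.piFinset (fun b => if b ∈ S then (Finset.univ : Finset ι) else {b}),
            w q e * ((∏ b ∈ S, w b (φ' b)) * (if insert e (S.image φ') = X then (1 : ℂ) else 0)) := Finset.sum_comm
      _ = ∑ e : ι, w q e * ∑ R', coef w S R' * (if insert e R' = X then (1 : ℂ) else 0) := by
          refine Finset.sum_congr rfl fun e _ => ?_
          rw [← Finset.mul_sum, hR e]
  rw [hswap]
  -- evaluate `Σ_{R'} coef S R' [insert e R' = X]`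
  have hinner : ∀ e : ι, ∑ R', coef w S R' * (if insert e R' = X then (1 : ℂ) else 0) =
      if e ∈ X then (if e = q then coef w S (X.erase q) else coef w S X + coef w S (X.erase e)) else 0 := by
    intro e
    by_cases heX : e ∈ X
    · rw [if_pos heX]
      -- the sets `R'` with `insert e R' = X` are `X` (if `e ∈ R'`) and `X.erase e`
      have hset : ∀ R' : Finset ι, insert e R' = X ↔ R' = X ∨ R' = X.erase e := by
        intro R'
        constructor
        · intro h
          by_cases he : e ∈ R'
          · left; rw [← h, Finset.insert_eq_of_mem he]
          · right; rw [← h, Finset.erase_insert he]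
        · rintro (rfl | rfl)
          · exact Finset.insert_eq_of_mem heX
          · exact Finset.insert_erase heX
      have hne : X ≠ X.erase e := fun h => (Finset.notMem_erase e X) (h ▸ heX)
      rw [← Finset.sum_subset (Finset.subset_univ ({X, X.erase e} : Finset (Finset ι)))]
      · rw [Finset.sum_pair hne, if_pos (Finset.insert_eq_of_mem heX), if_pos (Finset.insert_erase heX), mul_one, mul_one]
        by_cases heq : e = q
        · subst heq
          rw [if_pos rfl, coef_eq_zero_of_unfed_mem w hcol hqS heX, zero_add]
        · rw [if_neg heq]
      · intro R' _ hR'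
        rw [Finset.mem_insert, Finset.mem_singleton, not_or] at hR'
        have hno : ¬ insert e R' = X := by
          intro h
          rcases (hset R').1 h with h' | h'
          · exact hR'.1 h'
          · exact hR'.2 h'
        rw [if_neg hno, mul_zero]
    · rw [if_neg heX]
      refine Finset.sum_eq_zero fun R' _ => ?_
      have hno : ¬ insert e R' = X := fun h => heX (by rw [← h]; exact Finset.mem_insert_self e R')
      rw [if_neg hno, mul_zero]
  simp_rw [hinner]
  -- split the sum over `e` into `e = q` and `e ∈ X.erase q`
  rw [← Finset.sum_subset (Finset.subset_univ X)]
  · by_cases hqX : q ∈ X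
    · rw [← Finset.insert_erase hqX, Finset.sum_insert (Finset.notMem_erase q X), Finset.erase_insert (Finset.notMem_erase q X)]
      rw [if_pos (Finset.mem_insert_self _ _), if_pos rfl, hqq, one_mul, Finset.insert_erase hqX, if_pos hqX]
      congr 1
      refine Finset.sum_congr rfl fun d hd => ?_
      obtain ⟨hdq, hdX⟩ := Finset.mem_erase.1 hd
      rw [if_pos hdX, if_neg hdq]
    · rw [if_neg hqX, zero_add, Finset.erase_eq_of_notMem hqX]
      refine Finset.sum_congr rfl fun d hd => ?_
      have hdq : d ≠ q := fun h => hqX (h ▸ hd)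
      rw [if_pos hd, if_neg hdq]
  · intro e _ heX; rw [if_neg heX, mul_zero]

end SecondShell

end

end Summit.ValiantsHypothesis.ValiantsHypothesis.Theorems.BarrierLever.HiddenStates
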